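import Summits.Ventures.HSemireg.WedgeHankelRecurrenceKernel
import Summits.Ventures.HSemireg.WedgeHankelRecurrencePronyDivisors

/-!
# Venture HSemireg — THE RECURRENCES OF A SUM: `Rec_k(q + q′) = Rec_k(q) ⊓ Rec_k(q′) ↔ col H_k(q + q′) = col H_k(q) + col H_k(q′)`; a common multiple of two recurrences bounds the
# middle rank of the sum (`R(q + q′) ≤ deg lcm(m, m′)`); and **for classes whose minimal recurrences `m`, `m′` have full degree and are COPRIME the middle rank is ADDITIVE,
# `R(q + q′) = R(q) + R(q′)`, the minimal recurrence of the sum is the PRODUCT `m · m′`, the recurrences of the sum are the common recurrences and the column spaces are independent**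
# (the converse half of N18's sub-additivity; over a finite family with pairwise coprime minimal recurrences `R(Σ q_i) = Σ R(q_i)` and the minimal recurrence is `Π m_i`)

HONEST FRAMING. Part of the Lean index of the computation cell `pub-hsemireg` (seat p10 gen 27, Sunday typer «UNIFORM-IN-n»).
LINEAR ALGEBRA OF HANKEL (catalecticant) MATRICES and of polynomials over a field ONLY: no variety, no cohomology theory, no sheaf, no Ext group and no semiregularity map is constructed
here; nothing here says that HC / HC_CM / HC_AV holds; no Literature fact is declared or used.  Custodian versions as in `WedgeHankelSiegelIdeal` (1/3); the dictionary (`R(q) = rank H_{⌊N/2⌋}(q)`;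
`Rec_k(q)` = the recurrences of window `k + 1` = the left kernel of `H_k(q)`; a class with coprime minimal recurrences = classes with disjoint supports on the affine rational normal curve) is
QUOTED, never asserted.

WHAT IS IN THE TREE.  N18 (`WedgeHankelRecurrenceModule`): `recSpace`, `recSpace_inf_le_recSpace_add`, `mul_mem_recSpace_add`, `mul_mem_recSpace_add_seq`, `recSpace_smul_seq`, `recSpace_eq_bot_of_lt`,
`finrank_recSpace_eq_sub_min`, `recSpace_eq_degreeLT_of_lt`, `finrank_recSpace_self`, `recSpace_eq_map_mulRight`, `dvd_of_mem_recSpace`, `rank_hankel1_add_le`, `hankel1_add`,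
`natDegree_le_of_mem_recSpace`; N21 (`WedgeHankelRecurrenceKernel`): `inf_iInf_recSpace_eq_iff_iSup_range_eq` (common recurrences of a family ↔ the sum of its column spaces); N15
(`WedgeHankelRankProfileTrapezoid`) `rank_hankel1_eq_min`; N17 (`WedgeHankelRankProfileRecurrence`) `rank_hankel1_half_le_iff_exists_recurrence` (coefficient-vector form of §504, `2r ≤ N`).
Mathlib: `IsCoprime.dvd_of_dvd_mul_left`, `IsCoprime.mul_dvd`, `IsCoprime.prod_right`, `EuclideanDomain.lcm`, `Submodule.finrank_sup_add_finrank_inf_eq`, `iInf_bool_eq` / `iSup_bool_eq`.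
THIS FILE (namespace `Summit.Ventures.HSemireg.Wedge.HankelOuter` continued; PLAIN over the tree; 0 definitions):
* §504 **`recSpace_ne_bot_iff_rank_half_le`** (`Rec_k(q) ≠ 0 ↔ R(q) ≤ k`, every `k`, polynomial form of N17), `rank_hankel1_half_le_of_mem_recSpace` (a non-zero recurrence of window `k + 1`
  bounds `R(q) ≤ k`).
* §505 `range_hankel1_add_le_sup`, `recSpace_add_inf_le` (`Rec_k(q + q′) ⊓ Rec_k(q′) ⊆ Rec_k(q)`), **`recSpace_add_eq_inf_iff_range_eq_sup`** (`Rec_k(q + q′) = Rec_k(q) ⊓ Rec_k(q′) ↔ col H_k(q + q′)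
  = col H_k(q) ⊔ col H_k(q′)`), **`recSpace_add_eq_inf_of_rank_eq_add`** and `disjoint_range_hankel1_of_rank_eq_add` (ranks add ⇒ the column spaces are independent and the recurrences of the
  sum are the common ones).
* §506 **`rank_hankel1_half_add_le_of_dvd`** (a non-zero common multiple `L` of `m ∈ Rec_r(q)` and `m′ ∈ Rec_{r′}(q′)` is a common recurrence, so `R(q + q′) ≤ max(r + deg L − deg m, r′ + deg L −
  deg m′)`), **`rank_hankel1_half_add_le_natDegree_lcm`** (full degrees: `R(q + q′) ≤ deg lcm(m, m′)`).
* §507 for `R(q) = r = deg m`, `R(q′) = r′ = deg m′`, `IsCoprime m m′`: **`dvd_of_mem_recSpace_add_of_isCoprime`** (`k + r + r′ ≤ N + 1`: every recurrence of `q + q′` of window `k + 1` is a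
  multiple of `m` and of `m′`), **`recSpace_add_eq_inf_of_isCoprime`** (`Rec_k(q + q′) = Rec_k(q) ⊓ Rec_k(q′)`), **`recSpace_add_eq_bot_of_isCoprime`** (`k < r + r′ ⇒ Rec_k(q + q′) = 0`),
  **`rank_hankel1_half_add_eq_of_isCoprime`** (`2(r + r′) ≤ N + 2 ⇒ R(q + q′) = r + r′`: THE MIDDLE RANK IS ADDITIVE), **`recSpace_add_self_eq_span_mul_of_isCoprime`** (`2(r + r′) ≤ N + 1 ⇒
  Rec_{r+r′}(q + q′) = K · m m′`: THE MINIMAL RECURRENCE OF THE SUM IS THE PRODUCT), `recSpace_add_eq_map_mulRight_of_isCoprime`, **`range_hankel1_add_eq_sup_of_isCoprime`**,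
  **`rank_hankel1_add_eq_of_isCoprime`** / `disjoint_range_hankel1_of_isCoprime` (`r + r′ ≤ k + 1`, `k + r + r′ ≤ N + 1`: `col H_k(q + q′) = col H_k(q) ⊕ col H_k(q′)`).
* §508 finite families with PAIRWISE COPRIME full-degree minimal recurrences: **`rank_hankel1_half_sum_eq_of_pairwise_isCoprime`** (`R(Σ_i q_i) = Σ_i r_i`) and
  **`recSpace_sum_self_eq_span_prod_of_pairwise_isCoprime`** (`Rec_{Σ r_i}(Σ_i q_i) = K · Π_i m_i`) — N19/N20 (secant and divisor classes) are the split instances.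
READING: N18 proved `R(q + q′) ≤ R(q) + R(q′)` and `m · m′ ∈ Rec_{r+r′}(q + q′)`; this file says WHEN equality holds — exactly the Chinese-remainder situation: classes with coprime minimal
recurrences (disjoint supports, no node at infinity) do not interfere, their catalecticant column spaces are in direct sum inside the window and the sum remembers both summands
(`Rec(q + q′) = Rec(q) ∩ Rec(q′)`).  A degree drop of `m` (a node at infinity, N26/N29) is excluded here on purpose: `δ_N + δ_N` has `m = m′ = 1` coprime and `R = 1 ≠ 2`.
Nothing Ext-side.  New names only.
-/

open Module Polynomial
open scoped Matrix Polynomial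

namespace Summit.Ventures.HSemireg.Wedge.HankelOuter

open Summit.Ventures.HSemireg.Wedge Summit.Ventures.HSemireg.Wedge.Hankel

variable (K : Type*) [Field K] {N : ℕ}

/-! ## §504. A non-zero recurrence of window `k + 1` exists iff `R(q) ≤ k` -/

/-- **`Rec_k(q) ≠ 0 ↔ R(q) ≤ k`** (every `k`; for `k > N` both sides hold): the middle rank is the order of the shortest recurrence (N17), read on polynomials. -/
theorem recSpace_ne_bot_iff_rank_half_le (k : ℕ) (q : ℕ → K) :
    recSpace K N q k ≠ ⊥ ↔ (hankel1 K N (N / 2) q).rank ≤ k := by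
  constructor
  · intro h
    by_contra hlt
    exact h (recSpace_eq_bot_of_lt K rfl (by omega))
  · intro hle h0
    have h1 : finrank K (recSpace K N q k) = 0 := by rw [h0, finrank_bot]
    rcases Nat.lt_or_ge N k with hNk | hkN
    · rw [recSpace_eq_degreeLT_of_lt K hNk, finrank_polynomial_degreeLT] at h1
      omega
    · rw [finrank_recSpace_eq_sub_min K hkN] at h1
      have : min (min (k + 1) (N + 1 - k)) ((hankel1 K N (N / 2) q).rank) ≤ (hankel1 K N (N / 2) q).rank := min_le_right _ _
      omega

/-- a non-zero recurrence of window `k + 1` bounds the middle rank: `0 ≠ p ∈ Rec_k(q) ⇒ R(q) ≤ k`. -/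
theorem rank_hankel1_half_le_of_mem_recSpace {k : ℕ} {q : ℕ → K} {p : K[X]} (hp : p ∈ recSpace K N q k) (hp0 : p ≠ 0) :
    (hankel1 K N (N / 2) q).rank ≤ k :=
  (recSpace_ne_bot_iff_rank_half_le K k q).mp fun h => hp0 (by rw [h, Submodule.mem_bot] at hp; exact hp)

/-- `Rec_k(q) = 0 ↔ k < R(q)`. -/
theorem recSpace_eq_bot_iff_lt_rank_half (k : ℕ) (q : ℕ → K) : recSpace K N q k = ⊥ ↔ k < (hankel1 K N (N / 2) q).rank := by
  have h := recSpace_ne_bot_iff_rank_half_le K (N := N) k q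
  constructor
  · intro h0; by_contra hlt; exact (h.mpr (by omega)) h0
  · intro hlt; by_contra h0; have := h.mp h0; omega

/-! ## §505. The recurrences of a sum vs the sum of the column spaces -/

/-- `col H_k(q + q′) ⊆ col H_k(q) + col H_k(q′)`. -/
theorem range_hankel1_add_le_sup (k : ℕ) (q q' : ℕ → K) :
    LinearMap.range (hankel1 K N k (q + q')).mulVecLin ≤ LinearMap.range (hankel1 K N k q).mulVecLin ⊔ LinearMap.range (hankel1 K N k q').mulVecLin := by
  rintro _ ⟨v, rfl⟩
  rw [hankel1_add, Matrix.mulVecLin_add, LinearMap.add_apply]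
  exact Submodule.add_mem_sup (LinearMap.mem_range_self _ _) (LinearMap.mem_range_self _ _)

/-- `Rec_k(q + q′) ⊓ Rec_k(q′) ⊆ Rec_k(q)`: a recurrence of the sum and of one summand is a recurrence of the other. -/
theorem recSpace_add_inf_le (q q' : ℕ → K) (k : ℕ) : recSpace K N (q + q') k ⊓ recSpace K N q' k ≤ recSpace K N q k := by
  have h := recSpace_inf_le_recSpace_add K (N := N) (q + q') ((-1 : K) • q') k
  have e : q + q' + (-1 : K) • q' = q := by
    funext j; simp only [Pi.add_apply, Pi.smul_apply, smul_eq_mul]; ring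
  rw [recSpace_smul_seq K (neg_ne_zero.mpr one_ne_zero), e] at h
  exact h

/-- **`Rec_k(q + q′) = Rec_k(q) ⊓ Rec_k(q′)` iff `col H_k(q + q′) = col H_k(q) ⊔ col H_k(q′)`** — the recurrences of the sum are exactly the common recurrences iff the column space of the
sum is the whole sum of the column spaces (N21: recurrences and column spaces are each other's annihilators). -/
theorem recSpace_add_eq_inf_iff_range_eq_sup (k : ℕ) (q q' : ℕ → K) :
    recSpace K N (q + q') k = recSpace K N q k ⊓ recSpace K N q' k
      ↔ LinearMap.range (hankel1 K N k (q + q')).mulVecLin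
          = LinearMap.range (hankel1 K N k q).mulVecLin ⊔ LinearMap.range (hankel1 K N k q').mulVecLin := by
  have h := inf_iInf_recSpace_eq_iff_iSup_range_eq K (N := N) k (fun _ : Unit => q + q') (fun b : Bool => cond b q q')
  rw [iInf_const, iSup_const, iInf_bool_eq, iSup_bool_eq] at h
  simp only [cond_true, cond_false] at h
  rw [inf_eq_right.mpr (recSpace_le_degreeLT K (q + q') k), inf_eq_right.mpr (inf_le_left.trans (recSpace_le_degreeLT K q k))] at h
  exact h

/-- **if the ranks add, `rank H_k(q + q′) = rank H_k(q) + rank H_k(q′)`, then `Rec_k(q + q′) = Rec_k(q) ⊓ Rec_k(q′)`** (the column space of the sum, inside the sum of the column spaces,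
already has the maximal dimension). -/
theorem recSpace_add_eq_inf_of_rank_eq_add {k : ℕ} {q q' : ℕ → K} (h : (hankel1 K N k (q + q')).rank = (hankel1 K N k q).rank + (hankel1 K N k q').rank) :
    recSpace K N (q + q') k = recSpace K N q k ⊓ recSpace K N q' k := by
  rw [recSpace_add_eq_inf_iff_range_eq_sup]
  refine Submodule.eq_of_le_of_finrank_le (range_hankel1_add_le_sup K k q q') ?_
  refine (Submodule.finrank_add_le_finrank_add_finrank _ _).trans ?_
  simp only [Matrix.rank] at h
  omega

/-- … and then the two column spaces are independent: `col H_k(q) ⊓ col H_k(q′) = 0`. -/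
theorem disjoint_range_hankel1_of_rank_eq_add {k : ℕ} {q q' : ℕ → K} (h : (hankel1 K N k (q + q')).rank = (hankel1 K N k q).rank + (hankel1 K N k q').rank) :
    LinearMap.range (hankel1 K N k q).mulVecLin ⊓ LinearMap.range (hankel1 K N k q').mulVecLin = ⊥ := by
  have h1 := Submodule.finrank_sup_add_finrank_inf_eq (LinearMap.range (hankel1 K N k q).mulVecLin) (LinearMap.range (hankel1 K N k q').mulVecLin)
  have h2 := Submodule.finrank_mono (range_hankel1_add_le_sup K (N := N) k q q')
  simp only [Matrix.rank] at h
  rw [← Submodule.finrank_eq_zero]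
  omega

/-! ## §506. A common multiple of two recurrences is a recurrence of the sum: `R(q + q′) ≤ deg lcm(m, m′)` -/

/-- **a non-zero common multiple `L` of a recurrence `m ∈ Rec_r(q)` and a recurrence `m′ ∈ Rec_{r′}(q′)` is a common recurrence of window `j + 1` for
`j ≥ r + (deg L − deg m)`, `j ≥ r′ + (deg L − deg m′)`, hence `R(q + q′) ≤ j`.** -/
theorem rank_hankel1_half_add_le_of_dvd {r r' : ℕ} {q q' : ℕ → K} {m m' L : K[X]} (hm : m ∈ recSpace K N q r) (hm' : m' ∈ recSpace K N q' r')
    (hL0 : L ≠ 0) (hmL : m ∣ L) (hm'L : m' ∣ L) {j : ℕ} (hj : r + (L.natDegree - m.natDegree) ≤ j) (hj' : r' + (L.natDegree - m'.natDegree) ≤ j) :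
    (hankel1 K N (N / 2) (q + q')).rank ≤ j := by
  -- `L = a · m`, `deg a = deg L − deg m`, so `L ∈ Rec_{r + deg a}(q) ⊆ Rec_j(q)`; same for `q′`
  have key : ∀ {r₀ : ℕ} {q₀ : ℕ → K} {m₀ : K[X]}, m₀ ∈ recSpace K N q₀ r₀ → m₀ ∣ L → r₀ + (L.natDegree - m₀.natDegree) ≤ j → L ∈ recSpace K N q₀ j := by
    intro r₀ q₀ m₀ hm₀ hdvd hj₀
    obtain ⟨a, ha⟩ := hdvd
    have hm0 : m₀ ≠ 0 := fun h => hL0 (by rw [ha, h, zero_mul])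
    have ha0 : a ≠ 0 := fun h => hL0 (by rw [ha, h, mul_zero])
    have hdeg : L.natDegree - m₀.natDegree = a.natDegree := by rw [ha, Polynomial.natDegree_mul hm0 ha0]; omega
    rw [hdeg] at hj₀
    rw [ha, mul_comm]
    exact recSpace_mono K q₀ hj₀ (mul_mem_recSpace_add K ((mem_degreeLT_succ_iff K).mpr le_rfl) hm₀)
  exact rank_hankel1_half_le_of_mem_recSpace K (recSpace_inf_le_recSpace_add K q q' j (Submodule.mem_inf.mpr ⟨key hm hmL hj, key hm' hm'L hj'⟩)) hL0

/-- **`R(q + q′) ≤ deg lcm(m, m′)`** for non-zero recurrences `m ∈ Rec_r(q)`, `m′ ∈ Rec_{r′}(q′)` of full degrees `deg m = r`, `deg m′ = r′` (N18's sub-additivity `R ≤ r + r′` is the case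
`lcm = m · m′`). -/
theorem rank_hankel1_half_add_le_natDegree_lcm [DecidableEq K] {r r' : ℕ} {q q' : ℕ → K} {m m' : K[X]} (hm : m ∈ recSpace K N q r) (hm' : m' ∈ recSpace K N q' r')
    (hm0 : m ≠ 0) (hm'0 : m' ≠ 0) (hmr : m.natDegree = r) (hm'r : m'.natDegree = r') :
    (hankel1 K N (N / 2) (q + q')).rank ≤ (EuclideanDomain.lcm m m').natDegree := by
  have hL0 : EuclideanDomain.lcm m m' ≠ 0 := fun h => by
    rcases (EuclideanDomain.lcm_eq_zero_iff).mp h with h | h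
    · exact hm0 h
    · exact hm'0 h
  have h1 : m.natDegree ≤ (EuclideanDomain.lcm m m').natDegree := Polynomial.natDegree_le_of_dvd (EuclideanDomain.dvd_lcm_left m m') hL0
  have h2 : m'.natDegree ≤ (EuclideanDomain.lcm m m').natDegree := Polynomial.natDegree_le_of_dvd (EuclideanDomain.dvd_lcm_right m m') hL0
  exact rank_hankel1_half_add_le_of_dvd K hm hm' hL0 (EuclideanDomain.dvd_lcm_left m m') (EuclideanDomain.dvd_lcm_right m m') (by omega) (by omega)

/-! ## §507. Coprime minimal recurrences of full degree: the middle rank is additive and the minimal recurrence of the sum is the product -/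

section Coprime

variable {r r' : ℕ} {q q' : ℕ → K} {m m' : K[X]}

/-- the mechanism, one-sided: for `R(q) = r`, `0 ≠ m ∈ Rec_r(q)`, `m′ ∈ Rec_{r′}(q′)` with `deg m′ ≤ r′`, `IsCoprime m m′` and the window `k + r + r′ ≤ N + 1`, **every recurrence
`p ∈ Rec_k(q + q′)` is a multiple of `m`**: `m′ · p` is a recurrence of `q′` and of `q + q′`, hence of `q`, so `m ∣ m′ p` (N18) and coprimality removes `m′`. -/
theorem dvd_of_mem_recSpace_add_of_isCoprime (hq : (hankel1 K N (N / 2) q).rank = r) (hm : m ∈ recSpace K N q r) (hm0 : m ≠ 0)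
    (hm' : m' ∈ recSpace K N q' r') (hm'r : m'.natDegree ≤ r') (hcop : IsCoprime m m')
    {k : ℕ} (hk : k + r + r' ≤ N + 1) {p : K[X]} (hp : p ∈ recSpace K N (q + q') k) : m ∣ p := by
  have h1 : m' * p ∈ recSpace K N (q + q') (k + r') := mul_mem_recSpace_add K ((mem_degreeLT_succ_iff K).mpr hm'r) hp
  have h2 : m' * p ∈ recSpace K N q' (k + r') := by
    rw [mul_comm, add_comm]
    exact mul_mem_recSpace_add K (recSpace_le_degreeLT K _ k hp) hm'
  have h3 : m' * p ∈ recSpace K N q (k + r') := recSpace_add_inf_le K q q' _ (Submodule.mem_inf.mpr ⟨h1, h2⟩)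
  exact hcop.dvd_of_dvd_mul_left (dvd_of_mem_recSpace K hq (k := k + r') (by omega) hm hm0 h3)

variable (hq : (hankel1 K N (N / 2) q).rank = r) (hq' : (hankel1 K N (N / 2) q').rank = r')
  (hm : m ∈ recSpace K N q r) (hm' : m' ∈ recSpace K N q' r') (hm0 : m ≠ 0) (hm'0 : m' ≠ 0) (hmr : m.natDegree = r) (hm'r : m'.natDegree = r')
  (hcop : IsCoprime m m')
include hq hq' hm hm' hm0 hm'0 hmr hm'r hcop

/-- **THE RECURRENCES OF THE SUM ARE THE COMMON RECURRENCES: `Rec_k(q + q′) = Rec_k(q) ⊓ Rec_k(q′)`** inside the window `k + r + r′ ≤ N + 1` (coprime full-degree minimal recurrences). -/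
theorem recSpace_add_eq_inf_of_isCoprime {k : ℕ} (hk : k + r + r' ≤ N + 1) : recSpace K N (q + q') k = recSpace K N q k ⊓ recSpace K N q' k := by
  refine le_antisymm (fun p hp => ?_) (recSpace_inf_le_recSpace_add K q q' k)
  have hdeg := recSpace_le_degreeLT K _ k hp
  have hpk := (mem_degreeLT_succ_iff K).mp hdeg
  -- `m ∣ p` and `m′ ∣ p`; write `p = g m` with `deg g ≤ k − r`
  have key : ∀ {r₀ : ℕ} {q₀ : ℕ → K} {m₀ : K[X]}, m₀ ∈ recSpace K N q₀ r₀ → m₀ ≠ 0 → m₀.natDegree = r₀ → m₀ ∣ p → p ∈ recSpace K N q₀ k := by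
    intro r₀ q₀ m₀ hm₀ hm₀0 hm₀r hdvd
    obtain ⟨g, rfl⟩ := hdvd
    by_cases hg : g = 0
    · rw [hg, mul_zero]; exact Submodule.zero_mem _
    · have hdg : (m₀ * g).natDegree = r₀ + g.natDegree := by rw [Polynomial.natDegree_mul hm₀0 hg, hm₀r]
      rw [hdg] at hpk
      rw [mul_comm]
      exact recSpace_mono K q₀ (show r₀ + g.natDegree ≤ k by omega) (mul_mem_recSpace_add K ((mem_degreeLT_succ_iff K).mpr le_rfl) hm₀)
  refine Submodule.mem_inf.mpr ⟨key hm hm0 hmr ?_, key hm' hm'0 hm'r ?_⟩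
  · exact dvd_of_mem_recSpace_add_of_isCoprime K hq hm hm0 hm' hm'r.le hcop hk hp
  · have hp' : p ∈ recSpace K N (q' + q) k := by rwa [add_comm]
    exact dvd_of_mem_recSpace_add_of_isCoprime K hq' hm' hm'0 hm hmr.le hcop.symm (k := k) (by omega) hp'

/-- **no recurrence of the sum below `r + r′`: `Rec_k(q + q′) = 0` for `k < r + r′`, `k + r + r′ ≤ N + 1`** (a common multiple of the coprime `m`, `m′` has degree `≥ r + r′`). -/
theorem recSpace_add_eq_bot_of_isCoprime {k : ℕ} (hkr : k < r + r') (hk : k + r + r' ≤ N + 1) : recSpace K N (q + q') k = ⊥ := by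
  rw [Submodule.eq_bot_iff]
  intro p hp
  have hpk := (mem_degreeLT_succ_iff K).mp (recSpace_le_degreeLT K _ k hp)
  have h1 : m ∣ p := dvd_of_mem_recSpace_add_of_isCoprime K hq hm hm0 hm' hm'r.le hcop hk hp
  have h2 : m' ∣ p := dvd_of_mem_recSpace_add_of_isCoprime K hq' hm' hm'0 hm hmr.le hcop.symm (k := k) (by omega) (by rwa [add_comm])
  by_contra hp0
  have h := Polynomial.natDegree_le_of_dvd (hcop.mul_dvd h1 h2) hp0
  rw [Polynomial.natDegree_mul hm0 hm'0, hmr, hm'r] at h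
  omega

/-- **THE MIDDLE RANK IS ADDITIVE: `R(q + q′) = R(q) + R(q′)` for classes with coprime full-degree minimal recurrences and `2(r + r′) ≤ N + 2`.** -/
theorem rank_hankel1_half_add_eq_of_isCoprime (h2 : r + r' + (r + r') ≤ N + 2) : (hankel1 K N (N / 2) (q + q')).rank = r + r' := by
  refine le_antisymm (by rw [← hq, ← hq']; exact rank_hankel1_half_add_le K q q') ?_
  rcases Nat.eq_zero_or_pos (r + r') with h0 | hpos
  · omega
  · have := (recSpace_eq_bot_iff_lt_rank_half K (r + r' - 1) (q + q')).mp
      (recSpace_add_eq_bot_of_isCoprime K hq hq' hm hm' hm0 hm'0 hmr hm'r hcop (by omega) (by omega))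
    omega

/-- **THE MINIMAL RECURRENCE OF THE SUM IS THE PRODUCT: `Rec_{r+r′}(q + q′) = K · (m · m′)`** (`2(r + r′) ≤ N + 1`). -/
theorem recSpace_add_self_eq_span_mul_of_isCoprime (h2 : r + r' + (r + r') ≤ N + 1) : recSpace K N (q + q') (r + r') = K ∙ (m * m') := by
  haveI := finiteDimensional_recSpace K (N := N) (q + q') (r + r')
  symm
  refine Submodule.eq_of_le_of_finrank_eq ((Submodule.span_singleton_le_iff_mem _ _).mpr (mul_mem_recSpace_add_seq K hm hm')) ?_
  rw [finrank_span_singleton (mul_ne_zero hm0 hm'0),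
    finrank_recSpace_self K (rank_hankel1_half_add_eq_of_isCoprime K hq hq' hm hm' hm0 hm'0 hmr hm'r hcop (by omega)) h2]

/-- module form: **`Rec_{r+r′+d}(q + q′) = (m · m′) · K[X]_{≤ d}`** for `2(r + r′) + d ≤ N + 1`. -/
theorem recSpace_add_eq_map_mulRight_of_isCoprime {d : ℕ} (hd : r + r' + d + (r + r') ≤ N + 1) :
    recSpace K N (q + q') (r + r' + d) = (Polynomial.degreeLT K (d + 1)).map (LinearMap.mulRight K (m * m')) :=
  recSpace_eq_map_mulRight K (rank_hankel1_half_add_eq_of_isCoprime K hq hq' hm hm' hm0 hm'0 hmr hm'r hcop (by omega)) hd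
    (mul_mem_recSpace_add_seq K hm hm') (mul_ne_zero hm0 hm'0)

/-- column-space form: **`col H_k(q + q′) = col H_k(q) + col H_k(q′)`** inside the window `k + r + r′ ≤ N + 1`. -/
theorem range_hankel1_add_eq_sup_of_isCoprime {k : ℕ} (hk : k + r + r' ≤ N + 1) :
    LinearMap.range (hankel1 K N k (q + q')).mulVecLin = LinearMap.range (hankel1 K N k q).mulVecLin ⊔ LinearMap.range (hankel1 K N k q').mulVecLin :=
  (recSpace_add_eq_inf_iff_range_eq_sup K k q q').mp (recSpace_add_eq_inf_of_isCoprime K hq hq' hm hm' hm0 hm'0 hmr hm'r hcop hk)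

/-- **the ranks add: `rank H_k(q + q′) = rank H_k(q) + rank H_k(q′)` for `r + r′ ≤ k + 1`, `k + r + r′ ≤ N + 1`** (N15's trapezoid law on the three classes). -/
theorem rank_hankel1_add_eq_of_isCoprime {k : ℕ} (hrk : r + r' ≤ k + 1) (hk : k + r + r' ≤ N + 1) :
    (hankel1 K N k (q + q')).rank = (hankel1 K N k q).rank + (hankel1 K N k q').rank := by
  rcases Nat.lt_or_ge N k with hNk | hkN
  · -- `k = N + 1` (so `r = r′ = 0`): the three catalecticants have no columns
    have e : ∀ q₀ : ℕ → K, (hankel1 K N k q₀).rank = 0 := fun q₀ =>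
      Nat.eq_zero_of_le_zero ((Matrix.rank_le_width _).trans (by omega))
    rw [e, e, e]
  · have hR := rank_hankel1_half_add_eq_of_isCoprime K hq hq' hm hm' hm0 hm'0 hmr hm'r hcop (by omega)
    have h1 := rank_hankel1_eq_min K hkN (q + q')
    have h2 := rank_hankel1_eq_min K hkN q
    have h3 := rank_hankel1_eq_min K hkN q'
    rw [hR] at h1
    rw [hq] at h2
    rw [hq'] at h3
    omega

/-- **… so the column spaces are in direct sum: `col H_k(q) ⊓ col H_k(q′) = 0`** (`r + r′ ≤ k + 1`, `k + r + r′ ≤ N + 1`). -/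
theorem disjoint_range_hankel1_of_isCoprime {k : ℕ} (hrk : r + r' ≤ k + 1) (hk : k + r + r' ≤ N + 1) :
    LinearMap.range (hankel1 K N k q).mulVecLin ⊓ LinearMap.range (hankel1 K N k q').mulVecLin = ⊥ :=
  disjoint_range_hankel1_of_rank_eq_add K (rank_hankel1_add_eq_of_isCoprime K hq hq' hm hm' hm0 hm'0 hmr hm'r hcop hrk hk)

end Coprime

/-! ## §508. Finite families with pairwise coprime minimal recurrences: `R(Σ q_i) = Σ R(q_i)`, minimal recurrence `Π m_i` -/

section Family

variable {ι : Type*} (s : Finset ι) {qs : ι → ℕ → K} {rs : ι → ℕ} {ms : ι → K[X]}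
  (hq : ∀ i ∈ s, (hankel1 K N (N / 2) (qs i)).rank = rs i) (hm : ∀ i ∈ s, ms i ∈ recSpace K N (qs i) (rs i)) (hm0 : ∀ i ∈ s, ms i ≠ 0)
  (hmr : ∀ i ∈ s, (ms i).natDegree = rs i) (hcop : (s : Set ι).Pairwise fun i j => IsCoprime (ms i) (ms j))
include hq hm hm0 hmr hcop

/-- **ADDITIVITY OVER A FINITE FAMILY: for classes `q_i` with PAIRWISE COPRIME full-degree minimal recurrences `m_i` (`R(q_i) = r_i = deg m_i`) and `2 Σ_i r_i ≤ N + 2`,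
`R(Σ_i q_i) = Σ_i r_i`** (induction on the family: `Π_{j ≠ i} m_j` is coprime to `m_i`). -/
theorem rank_hankel1_half_sum_eq_of_pairwise_isCoprime (h2 : (∑ i ∈ s, rs i) + (∑ i ∈ s, rs i) ≤ N + 2) :
    (hankel1 K N (N / 2) (∑ i ∈ s, qs i)).rank = ∑ i ∈ s, rs i := by
  classical
  induction s using Finset.induction_on with
  | empty =>
    rw [Finset.sum_empty, Finset.sum_empty]
    have hz : hankel1 K N (N / 2) (0 : ℕ → K) = 0 := by ext i j; rfl
    rw [hz, Matrix.rank_zero]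
  | insert a s ha ih =>
    simp only [Finset.sum_insert ha] at h2 ⊢
    have hq_s := fun i hi => hq i (Finset.mem_insert_of_mem hi)
    have hm_s := fun i hi => hm i (Finset.mem_insert_of_mem hi)
    have hm0_s := fun i hi => hm0 i (Finset.mem_insert_of_mem hi)
    have hmr_s := fun i hi => hmr i (Finset.mem_insert_of_mem hi)
    have hcop_s : (s : Set ι).Pairwise fun i j => IsCoprime (ms i) (ms j) := hcop.mono (by simp only [Finset.coe_insert, Set.subset_insert])
    have hR := ih hq_s hm_s hm0_s hmr_s hcop_s (by omega)
    -- the product `Π_{i ∈ s} m_i` is the (full-degree, non-zero) minimal recurrence of `Σ_{i ∈ s} q_i`, coprime to `m_a`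
    have hprod : (∏ i ∈ s, ms i) ∈ recSpace K N (∑ i ∈ s, qs i) (∑ i ∈ s, rs i) := prod_mem_recSpace_sum K s ms rs qs hm_s
    have hprod0 : (∏ i ∈ s, ms i) ≠ 0 := Finset.prod_ne_zero_iff.mpr hm0_s
    have hprodr : (∏ i ∈ s, ms i).natDegree = ∑ i ∈ s, rs i := by
      rw [Polynomial.natDegree_prod _ _ hm0_s]; exact Finset.sum_congr rfl hmr_s
    have hcopa : IsCoprime (ms a) (∏ i ∈ s, ms i) :=
      IsCoprime.prod_right fun i hi => hcop (Finset.mem_coe.mpr (Finset.mem_insert_self a s)) (Finset.mem_coe.mpr (Finset.mem_insert_of_mem hi))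
        (fun h => ha (by rw [h]; exact hi))
    exact rank_hankel1_half_add_eq_of_isCoprime K (hq a (Finset.mem_insert_self a s)) hR (hm a (Finset.mem_insert_self a s)) hprod
      (hm0 a (Finset.mem_insert_self a s)) hprod0 (hmr a (Finset.mem_insert_self a s)) hprodr hcopa h2

/-- **… and the minimal recurrence of the sum is the product: `Rec_{Σ r_i}(Σ_i q_i) = K · Π_i m_i`** (`2 Σ_i r_i ≤ N + 1`). -/
theorem recSpace_sum_self_eq_span_prod_of_pairwise_isCoprime (h2 : (∑ i ∈ s, rs i) + (∑ i ∈ s, rs i) ≤ N + 1) :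
    recSpace K N (∑ i ∈ s, qs i) (∑ i ∈ s, rs i) = K ∙ ∏ i ∈ s, ms i := by
  haveI := finiteDimensional_recSpace K (N := N) (∑ i ∈ s, qs i) (∑ i ∈ s, rs i)
  symm
  refine Submodule.eq_of_le_of_finrank_eq ((Submodule.span_singleton_le_iff_mem _ _).mpr (prod_mem_recSpace_sum K s ms rs qs hm)) ?_
  rw [finrank_span_singleton (Finset.prod_ne_zero_iff.mpr hm0),
    finrank_recSpace_self K (rank_hankel1_half_sum_eq_of_pairwise_isCoprime K s hq hm hm0 hmr hcop (by omega)) h2]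

end Family

end Summit.Ventures.HSemireg.Wedge.HankelOuter
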